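import Mathlib
import HarnessLib
import Summits.Langlands.Langlands.Theses.SkinnerWilesDefectOne
import Summits.Langlands.Langlands.Theorems.SkinnerWilesDefectOneReducibleOrdinaryProModularDefs
import Literature.NumberTheory.GaloisRepresentations.NearlyOrdinaryDeformationRing
import Literature.AlgebraicGeometry.Resolution.FormalEquidimensionality
import Literature.AlgebraicGeometry.Resolution.ExcellentRingsCompleteUC

/-!
# Uniqueness of the universal nearly ordinary deformation ring and the commutative-algebra half
# of the presentation bound (helpers of stub `stub_presentationBound`)

Route `SkinnerWilesDefectOne`, crux `ReducibleOrdinaryProModular` (stmt-Langlands-12919), line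
`fine-selmer-codimension-two`, helper file of stub `stub_presentationBound` (X2: "every irreducible
component of `Spec R_𝒟` has Krull dimension `≥ 4 = dim Λ_F − l₀`", [SW, Prop. 2.4]-type bound over an
imaginary quadratic field).  The stub quantifies over an ARBITRARY instance `M.𝓡` of the tree's
INTERFACE `NearlyOrdinaryDeformationRing M.𝒟`; the intended proof (Böckle / Kisin presentation
`R_𝒟 ≅ A/(f₁,…,f_r)` over the local Borel lifting rings, then Krull's height theorem in the
Cohen–Macaulay ring `A`) is a statement about ONE constructed ring.  This file proves, sorry-free,
the three pieces of PLUMBING that reduce X2 to its two genuinely missing inputs (the presentation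
theorem and the Cohen–Macaulay property of the Borel lifting rings, see the worker report):

* §1 `exists_algEquiv_isStrictEquiv` — **two universal nearly ordinary deformation rings of the same
  residual datum are isomorphic** as `𝒪`-algebras, by an isomorphism carrying `ρ_𝒟` to `ρ'_𝒟` up to
  strict equivalence (Yoneda: `R` itself is a test ring of the universal property; Mazur §20 Prop. 2 /
  [SW, §2.1] "the universal deformation of type-`𝒟`"); pushed-forward strict equivalences
  (`isStrictEquiv_map`); the registered sub-goal `stub_presentationBound_auxUnique`.
* §2 `forall_le_ringKrullDim_quotient_minimalPrimes_of_ringEquiv` — the X2 property ("every minimal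
  prime has quotient of dimension `≥ d`") is invariant under ring isomorphisms; with §1 it transfers
  between any two instances of the interface (registered sub-goal `stub_presentationBound_auxTransport`).
* §3 `ringKrullDim_le_ringKrullDim_quotient_add_spanFinrank_of_isCatenaryRing` — **Krull's height
  theorem componentwise**: in a CATENARY, EQUIDIMENSIONAL noetherian local ring `A`, every minimal
  prime `𝔮` of an ideal `I` generated by `r` elements has `dim A/𝔮 ≥ dim A − r` (Mathlib's
  `ringKrullDim_le_ringKrullDim_quotient_add_spanFinrank` bounds only the LARGEST component of `A/I`);
  catenarity is free for complete local rings (the tree's `isUniversallyCatenaryRing_of_isAdicComplete`,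
  Stacks 032C), whence `…_of_isAdicComplete`, and the packaged reduction
  `forall_le_ringKrullDim_quotient_of_presentation`: a presentation `R ≃ A ⧸ I` with `A` complete
  local equidimensional and `n + r ≤ dim A`, `I` generated by `r` elements, gives `dim R/C ≥ n` for
  every minimal prime `C` of `R` (registered sub-goal `stub_presentationBound_auxKrull`).

Mathlib / tree lemmas used (pin): `Ideal.height_le_spanRank_toENat_of_mem_minimalPrimes` (Krull's
height theorem), `IsLocalRing.maximalIdeal_height_eq_ringKrullDim`, `Ideal.exists_minimalPrimes_le`,
`Ideal.minimalPrimes_eq_comap`, `DoubleQuot.quotQuotEquivQuotOfLE`, `ringKrullDim_eq_of_ringEquiv`;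
tree: `IsCatenaryRing.height_eq_height_add_height_map_quotientMk`, `height_add_height_map_quotientMk_le`,
`IsCatenaryRing.quotient`, `isUniversallyCatenaryRing_of_isAdicComplete`,
`comap_mem_minimalPrimes_of_ringEquiv`, `ringKrullDim_quotient_comap_ringEquiv`
(`Literature.AlgebraicGeometry.Resolution`).

References: B. Mazur, *An introduction to the deformation theory of Galois representations* (1997),
§20 Prop. 2 [Mazur1997Deformation]; C. M. Skinner, A. J. Wiles, *Residually reducible representations
and modular forms*, Publ. Math. IHÉS 89 (1999), §2.1 and Prop. 2.4-type count [SkinnerWiles1999];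
H. Matsumura, *Commutative Ring Theory* (1986), Thm. 13.5 (Krull), §5 p. 31 and Thm. 17.4
(catenary, CM) [Matsumura1987]; The Stacks Project, Tag 032C [StacksProject].
-/

set_option linter.dupNamespace false -- project-wide option (lakefile weak.linter.dupNamespace); `Summit.Langlands.Langlands` is the mandated namespace

namespace Summit.Langlands.Langlands.Theorems

open IsLocalRing Matrix
open Literature.NumberTheory.GaloisRepresentations
open Literature.AlgebraicGeometry.Resolution

universe u

/-! ## 1. Uniqueness of the universal nearly ordinary deformation ring up to isomorphism -/

section Uniqueness

variable {F : Type*} [Field F] [NumberField F] {p : ℕ} {𝒪 : Type*} [CommRing 𝒪] {k : Type*}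
  [Field k] [Algebra 𝒪 k] {𝒟 : NearlyOrdinaryDatum F p 𝒪 k}

/-- **Strict equivalences push forward** along a ring homomorphism compatible with the
augmentations (`π_B ∘ f = π_A`): conjugate by the image of the conjugating matrix, which still
reduces to `1`. [cite: Mazur1997Deformation, §8 and §20 Prop. 2] -/
theorem isStrictEquiv_map {Γ : Type*} [Group Γ] {n : ℕ} {A B : Type*} [CommRing A] [CommRing B]
    {πA : A →+* k} {πB : B →+* k} (f : A →+* B) (hf : πB.comp f = πA)
    {ρ ρ' : Γ →* GL (Fin n) A} (h : Deformation.IsStrictEquiv πA ρ ρ') :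
    Deformation.IsStrictEquiv πB ((GeneralLinearGroup.map f).comp ρ)
      ((GeneralLinearGroup.map f).comp ρ') := by
  obtain ⟨P, hP, hρ⟩ := h
  refine ⟨GeneralLinearGroup.map f P, ?_, fun γ => ?_⟩
  · rw [← GeneralLinearGroup.map_comp_apply, ← GeneralLinearGroup.map_comp, hf, hP]
  · simp only [MonoidHom.comp_apply, hρ γ, map_mul, map_inv]

/-- The comparison map between two universal rings of the same datum: an `𝒪`-algebra map
`φ : R → R'` with `φ ∘ ρ_𝒟` strictly equivalent to `ρ'_𝒟` (universality of `R` applied to the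
deformation `ρ'_𝒟` of type `𝒟`). [cite: SkinnerWiles1999, §2.1] -/
theorem exists_algHom_isStrictEquiv (𝓡 𝓡' : NearlyOrdinaryDeformationRing.{u} 𝒟) :
    ∃ φ : 𝓡.R →ₐ[𝒪] 𝓡'.R, Deformation.IsStrictEquiv (𝓡'.π : 𝓡'.R →+* k)
      ((GeneralLinearGroup.map (φ : 𝓡.R →+* 𝓡'.R)).comp 𝓡.ρ) 𝓡'.ρ :=
  (𝓡.universal 𝓡'.R 𝓡'.π 𝓡'.π_surjective 𝓡'.ρ 𝓡'.isDeformation).exists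

/-- An `𝒪`-algebra endomorphism of a universal ring fixing `ρ_𝒟` up to strict equivalence is the
identity (uniqueness half of the universal property, tested on `R` itself).
[cite: Mazur1997Deformation, §8 and §20 Prop. 2] -/
theorem algHom_eq_id (𝓡 : NearlyOrdinaryDeformationRing.{u} 𝒟) (ψ : 𝓡.R →ₐ[𝒪] 𝓡.R)
    (hψ : Deformation.IsStrictEquiv (𝓡.π : 𝓡.R →+* k)
      ((GeneralLinearGroup.map (ψ : 𝓡.R →+* 𝓡.R)).comp 𝓡.ρ) 𝓡.ρ) :
    ψ = AlgHom.id 𝒪 𝓡.R := by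
  have hid : Deformation.IsStrictEquiv (𝓡.π : 𝓡.R →+* k)
      ((GeneralLinearGroup.map ((AlgHom.id 𝒪 𝓡.R : 𝓡.R →ₐ[𝒪] 𝓡.R) : 𝓡.R →+* 𝓡.R)).comp 𝓡.ρ)
      𝓡.ρ := by
    rw [AlgHom.id_toRingHom, GeneralLinearGroup.map_id, MonoidHom.id_comp]
    exact Deformation.IsStrictEquiv.refl _ _
  exact (𝓡.universal 𝓡.R 𝓡.π 𝓡.π_surjective 𝓡.ρ 𝓡.isDeformation).unique hψ hid

/-- The composite of two comparison maps fixes `ρ_𝒟` up to strict equivalence, hence is the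
identity. [cite: Mazur1997Deformation, §8 and §20 Prop. 2] -/
theorem algHom_comp_eq_id (𝓡 𝓡' : NearlyOrdinaryDeformationRing.{u} 𝒟) (φ : 𝓡.R →ₐ[𝒪] 𝓡'.R)
    (ψ : 𝓡'.R →ₐ[𝒪] 𝓡.R)
    (hφ : Deformation.IsStrictEquiv (𝓡'.π : 𝓡'.R →+* k)
      ((GeneralLinearGroup.map (φ : 𝓡.R →+* 𝓡'.R)).comp 𝓡.ρ) 𝓡'.ρ)
    (hψ : Deformation.IsStrictEquiv (𝓡.π : 𝓡.R →+* k)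
      ((GeneralLinearGroup.map (ψ : 𝓡'.R →+* 𝓡.R)).comp 𝓡'.ρ) 𝓡.ρ) :
    ψ.comp φ = AlgHom.id 𝒪 𝓡.R := by
  refine algHom_eq_id 𝓡 (ψ.comp φ) ?_
  have hπ : (𝓡.π : 𝓡.R →+* k).comp (ψ : 𝓡'.R →+* 𝓡.R) = (𝓡'.π : 𝓡'.R →+* k) :=
    RingHom.ext fun x => DFunLike.congr_fun (𝓡'.augmentation_comp 𝓡.π ψ) x
  rw [AlgHom.comp_toRingHom, GeneralLinearGroup.map_comp, MonoidHom.comp_assoc]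
  exact (isStrictEquiv_map (ψ : 𝓡'.R →+* 𝓡.R) hπ hφ).trans hψ

/-- **Uniqueness of the universal nearly ordinary deformation ring.**  Two instances `𝓡`, `𝓡'` of the
interface `NearlyOrdinaryDeformationRing 𝒟` (complete noetherian local `𝒪`-algebras with residue
field `k`, universal among type-`𝒟` deformations to such rings in the same universe) are
canonically isomorphic: there is an `𝒪`-algebra isomorphism `e : R ≃ R'` with `e ∘ ρ_𝒟` strictly
equivalent to `ρ'_𝒟` ("there is a universal deformation of type-`𝒟`" — unique up to unique
isomorphism, since `R` and `R'` are themselves test rings). [cite: SkinnerWiles1999, §2.1] -/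
theorem exists_algEquiv_isStrictEquiv (𝓡 𝓡' : NearlyOrdinaryDeformationRing.{u} 𝒟) :
    ∃ e : 𝓡.R ≃ₐ[𝒪] 𝓡'.R, Deformation.IsStrictEquiv (𝓡'.π : 𝓡'.R →+* k)
      ((GeneralLinearGroup.map ((e : 𝓡.R →ₐ[𝒪] 𝓡'.R) : 𝓡.R →+* 𝓡'.R)).comp 𝓡.ρ) 𝓡'.ρ := by
  obtain ⟨φ, hφ⟩ := exists_algHom_isStrictEquiv 𝓡 𝓡'
  obtain ⟨ψ, hψ⟩ := exists_algHom_isStrictEquiv 𝓡' 𝓡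
  exact ⟨AlgEquiv.ofAlgHom φ ψ (algHom_comp_eq_id 𝓡' 𝓡 ψ φ hψ hφ)
    (algHom_comp_eq_id 𝓡 𝓡' φ ψ hφ hψ), hφ⟩

/-- In particular the underlying rings of two universal rings of the same datum are isomorphic.
[cite: SkinnerWiles1999, §2.1] -/
theorem nonempty_ringEquiv (𝓡 𝓡' : NearlyOrdinaryDeformationRing.{u} 𝒟) :
    Nonempty (𝓡.R ≃+* 𝓡'.R) := by
  obtain ⟨e, -⟩ := exists_algEquiv_isStrictEquiv 𝓡 𝓡'
  exact ⟨e.toRingEquiv⟩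

end Uniqueness

/-! ## 2. Transport of the componentwise dimension bound along isomorphisms -/

section Transport

variable {R R' : Type u} [CommRing R] [CommRing R']

/-- **"Every minimal prime has quotient of dimension `≥ d`" is invariant under ring
isomorphisms** (minimal primes correspond and the quotients are isomorphic). [folklore] -/
theorem forall_le_ringKrullDim_quotient_minimalPrimes_of_ringEquiv (e : R ≃+* R')
    {d : WithBot ℕ∞} (h : ∀ P ∈ minimalPrimes R, d ≤ ringKrullDim (R ⧸ P)) :
    ∀ P ∈ minimalPrimes R', d ≤ ringKrullDim (R' ⧸ P) := fun P hP => by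
  rw [← ringKrullDim_quotient_comap_ringEquiv e P]
  exact h _ (comap_mem_minimalPrimes_of_ringEquiv e hP)

variable {F : Type*} [Field F] [NumberField F] {p : ℕ} {𝒪 : Type*} [CommRing 𝒪] {k : Type*}
  [Field k] [Algebra 𝒪 k] {𝒟 : NearlyOrdinaryDatum F p 𝒪 k}

/-- **X2 transfers between instances of the interface**: if every minimal prime of ONE universal
nearly ordinary deformation ring of `𝒟` has quotient of Krull dimension `≥ d`, the same holds for
EVERY universal nearly ordinary deformation ring of `𝒟` (so the presentation bound may be proved
for the constructed ring and transported to `M.𝓡`). [cite: SkinnerWiles1999, §2.1] -/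
theorem forall_le_ringKrullDim_quotient_minimalPrimes_of_nearlyOrdinaryDeformationRing
    (𝓡 𝓡' : NearlyOrdinaryDeformationRing.{u} 𝒟) {d : WithBot ℕ∞}
    (h : ∀ C : PrimeSpectrum 𝓡.R, C.asIdeal ∈ minimalPrimes 𝓡.R → d ≤ ringKrullDim (𝓡.R ⧸ C.asIdeal))
    (C : PrimeSpectrum 𝓡'.R) (hC : C.asIdeal ∈ minimalPrimes 𝓡'.R) :
    d ≤ ringKrullDim (𝓡'.R ⧸ C.asIdeal) := by
  obtain ⟨e⟩ := nonempty_ringEquiv 𝓡 𝓡'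
  exact forall_le_ringKrullDim_quotient_minimalPrimes_of_ringEquiv e
    (fun P hP => h ⟨P, hP.1.1⟩ hP) C.asIdeal hC

end Transport

/-! ## 3. Krull's height theorem componentwise in catenary equidimensional local rings -/

section Krull

variable {A : Type u} [CommRing A] [IsNoetherianRing A] [IsLocalRing A]

/-- **Krull's height theorem, componentwise form.**  Let `A` be a noetherian local ring which is
CATENARY and EQUIDIMENSIONAL (`dim A/𝔓 = dim A` for every minimal prime `𝔓`).  Then for every
ideal `I` and every minimal prime `𝔮` of `I`: `dim A ≤ dim A/𝔮 + μ(I)`, `μ(I) = I.spanFinrank` the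
minimal number of generators — i.e. EVERY irreducible component of `Spec A/I` has dimension
`≥ dim A − μ(I)`.  Proof: `ht 𝔮 ≤ μ(I)` (Krull, Matsumura Thm. 13.5); for a minimal prime `𝔓 ⊆ 𝔮`
the catenary local domain `A/𝔓` satisfies `dim A/𝔓 = ht(𝔮/𝔓) + dim A/𝔮` (Matsumura §5 p. 31), and
`ht(𝔮/𝔓) ≤ ht 𝔮`, `dim A/𝔓 = dim A`. [cite: Matsumura1987, Thm. 13.5 and §5 p. 31] -/
theorem ringKrullDim_le_ringKrullDim_quotient_add_spanFinrank_of_isCatenaryRing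
    (hcat : IsCatenaryRing A) (heq : ∀ 𝔓 ∈ minimalPrimes A, ringKrullDim (A ⧸ 𝔓) = ringKrullDim A)
    (I : Ideal A) {𝔮 : Ideal A} (h𝔮 : 𝔮 ∈ I.minimalPrimes) :
    ringKrullDim A ≤ ringKrullDim (A ⧸ 𝔮) + I.spanFinrank := by
  haveI h𝔮p : 𝔮.IsPrime := h𝔮.1.1
  -- Krull's height theorem: `ht 𝔮 ≤ μ(I)`
  have hKrull : 𝔮.height ≤ I.spanFinrank := by
    have h := I.height_le_spanRank_toENat_of_mem_minimalPrimes 𝔮 h𝔮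
    rwa [Submodule.fg_iff_spanRank_eq_spanFinrank.mpr (IsNoetherian.noetherian I),
      map_natCast] at h
  -- a minimal prime `𝔓 ⊆ 𝔮` of `A`; `B = A/𝔓` is a catenary noetherian local domain
  obtain ⟨𝔓, h𝔓, h𝔓𝔮⟩ := Ideal.exists_minimalPrimes_le (show (⊥ : Ideal A) ≤ 𝔮 from bot_le)
  haveI h𝔓p : 𝔓.IsPrime := h𝔓.1.1
  haveI : IsLocalRing (A ⧸ 𝔓) := .of_surjective' _ Ideal.Quotient.mk_surjective
  have hcatB : IsCatenaryRing (A ⧸ 𝔓) := hcat.quotient 𝔓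
  -- `Q = 𝔮/𝔓`
  set Q : Ideal (A ⧸ 𝔓) := 𝔮.map (Ideal.Quotient.mk 𝔓) with hQdef
  haveI hQp : Q.IsPrime := Ideal.isPrime_map_quotientMk_of_isPrime h𝔓𝔮
  have hQle : Q ≤ maximalIdeal (A ⧸ 𝔓) := IsLocalRing.le_maximalIdeal hQp.ne_top
  -- dimension formula in the catenary domain `B`: `ht 𝔪_B = ht Q + ht(𝔪_B/Q)`
  have hform := hcatB.height_eq_height_add_height_map_quotientMk hQle
  -- `ht 𝔪_B = dim B = dim A`
  have h1 : ((maximalIdeal (A ⧸ 𝔓)).height : WithBot ℕ∞) = ringKrullDim A := by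
    rw [IsLocalRing.maximalIdeal_height_eq_ringKrullDim, heq 𝔓 h𝔓]
  -- `ht(𝔪_B/Q) = dim B/Q = dim A/𝔮`
  have h2 : (((maximalIdeal (A ⧸ 𝔓)).map (Ideal.Quotient.mk Q)).height : WithBot ℕ∞) =
      ringKrullDim (A ⧸ 𝔮) := by
    haveI : Nontrivial ((A ⧸ 𝔓) ⧸ Q) := Ideal.Quotient.nontrivial_iff.mpr hQp.ne_top
    haveI : IsLocalRing ((A ⧸ 𝔓) ⧸ Q) := .of_surjective' _ Ideal.Quotient.mk_surjective
    rw [IsLocalRing.map_maximalIdeal_of_surjective _ Ideal.Quotient.mk_surjective,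
      IsLocalRing.maximalIdeal_height_eq_ringKrullDim]
    exact ringKrullDim_eq_of_ringEquiv (DoubleQuot.quotQuotEquivQuotOfLE h𝔓𝔮)
  -- `ht Q ≤ ht 𝔮 ≤ μ(I)`
  have h3 : Q.height ≤ I.spanFinrank := by
    have h := height_add_height_map_quotientMk_le h𝔓𝔮
    exact (le_add_self.trans h).trans hKrull
  have h3' : (Q.height : WithBot ℕ∞) ≤ (I.spanFinrank : WithBot ℕ∞) := by exact_mod_cast h3
  calc ringKrullDim A = ((maximalIdeal (A ⧸ 𝔓)).height : WithBot ℕ∞) := h1.symm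
    _ = (Q.height : WithBot ℕ∞) +
          (((maximalIdeal (A ⧸ 𝔓)).map (Ideal.Quotient.mk Q)).height : WithBot ℕ∞) := by
        rw [hform, WithBot.coe_add]
    _ ≤ (I.spanFinrank : WithBot ℕ∞) + ringKrullDim (A ⧸ 𝔮) := by
        rw [h2]
        exact add_le_add h3' le_rfl
    _ = ringKrullDim (A ⧸ 𝔮) + I.spanFinrank := add_comm _ _

/-- **Componentwise Krull bound in a COMPLETE equidimensional local ring** — catenarity is automatic
(complete noetherian local rings are universally catenary, Stacks 032C, the tree's
`isUniversallyCatenaryRing_of_isAdicComplete`). [cite: StacksProject, Tag 032C] -/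
theorem ringKrullDim_le_ringKrullDim_quotient_add_spanFinrank_of_isAdicComplete
    [IsAdicComplete (maximalIdeal A) A]
    (heq : ∀ 𝔓 ∈ minimalPrimes A, ringKrullDim (A ⧸ 𝔓) = ringKrullDim A)
    (I : Ideal A) {𝔮 : Ideal A} (h𝔮 : 𝔮 ∈ I.minimalPrimes) :
    ringKrullDim A ≤ ringKrullDim (A ⧸ 𝔮) + I.spanFinrank :=
  ringKrullDim_le_ringKrullDim_quotient_add_spanFinrank_of_isCatenaryRing
    (isUniversallyCatenaryRing_of_isAdicComplete A).isCatenaryRing heq I h𝔮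

/-- **The presentation bound, reduced to its inputs.**  If a ring `R` admits a presentation
`R ≃ A ⧸ I` with `A` a COMPLETE noetherian local ring which is EQUIDIMENSIONAL, `I` generated by
`μ(I)` elements and `n + μ(I) ≤ dim A`, then every minimal prime `C` of `R` has `dim R/C ≥ n`
(minimal primes of `A/I` are the minimal primes of `I`; `(A/I)/(𝔮/I) ≅ A/𝔮`; the componentwise
Krull bound).  For X2: `R = R_𝒟`, `A = (⊗̂_{v∣p} R_v^{Bor})⟦x₁,…,x_g⟧`, `μ(I) ≤ r`, `n = 4`,
`dim A − r ≥ 4` by the `h¹ − h²` count. [cite: Matsumura1987, Thm. 13.5 and §5 p. 31] -/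
theorem forall_le_ringKrullDim_quotient_of_presentation {R : Type u} [CommRing R]
    (A : Type u) [CommRing A] [IsNoetherianRing A] [IsLocalRing A] [IsAdicComplete (maximalIdeal A) A]
    (heq : ∀ 𝔓 ∈ minimalPrimes A, ringKrullDim (A ⧸ 𝔓) = ringKrullDim A)
    (I : Ideal A) (e : R ≃+* A ⧸ I) (n : ℕ)
    (hn : (n : WithBot ℕ∞) + I.spanFinrank ≤ ringKrullDim A) :
    ∀ C ∈ minimalPrimes R, (n : WithBot ℕ∞) ≤ ringKrullDim (R ⧸ C) := by
  refine forall_le_ringKrullDim_quotient_minimalPrimes_of_ringEquiv e.symm fun P hP => ?_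
  -- `P = 𝔮/I` for a minimal prime `𝔮` of `I`
  have h𝔮 : P.comap (Ideal.Quotient.mk I) ∈ I.minimalPrimes := by
    rw [Ideal.minimalPrimes_eq_comap]
    exact Set.mem_image_of_mem _ hP
  set 𝔮 := P.comap (Ideal.Quotient.mk I) with h𝔮def
  have hI𝔮 : I ≤ 𝔮 := h𝔮.1.2
  have hP𝔮 : P = 𝔮.map (Ideal.Quotient.mk I) := by
    rw [h𝔮def, Ideal.map_comap_of_surjective _ Ideal.Quotient.mk_surjective]
  have hdim : ringKrullDim ((A ⧸ I) ⧸ P) = ringKrullDim (A ⧸ 𝔮) := by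
    rw [hP𝔮]
    exact ringKrullDim_eq_of_ringEquiv (DoubleQuot.quotQuotEquivQuotOfLE hI𝔮)
  rw [hdim]
  have hb := ringKrullDim_le_ringKrullDim_quotient_add_spanFinrank_of_isAdicComplete heq I h𝔮
  -- `n + μ(I) ≤ dim A ≤ dim A/𝔮 + μ(I)`; cancel the finite `μ(I)` (in `ℕ∞`, `A/𝔮 ≠ 0`)
  have hle : (n : WithBot ℕ∞) + I.spanFinrank ≤ ringKrullDim (A ⧸ 𝔮) + I.spanFinrank :=
    hn.trans hb
  haveI : Nontrivial (A ⧸ 𝔮) := Ideal.Quotient.nontrivial_iff.mpr h𝔮.1.1.ne_top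
  haveI : IsLocalRing (A ⧸ 𝔮) := .of_surjective' _ Ideal.Quotient.mk_surjective
  rw [← IsLocalRing.maximalIdeal_height_eq_ringKrullDim] at hle ⊢
  have hle' : (n : ℕ∞) + I.spanFinrank ≤ (maximalIdeal (A ⧸ 𝔮)).height + I.spanFinrank := by
    exact_mod_cast hle
  exact_mod_cast (WithTop.add_le_add_iff_right (ENat.coe_ne_top I.spanFinrank)).mp hle'

end Krull

end Summit.Langlands.Langlands.Theorems

/-! ## 4. The registered sub-goals (verbatim signatures) -/

namespace Summit.Langlands.Langlands.Cruxes.ReducibleOrdinaryProModular.FineSelmerCodimensionTwo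

open scoped NumberField MatrixGroups
open Filter NumberField IsDedekindDomain Field Matrix
open Literature.NumberTheory.Automorphic Literature.NumberTheory.Automorphic.BigHeckeGLn
open Literature.NumberTheory.GaloisRepresentations
open Summit.Langlands.Langlands.Theses.SkinnerWilesDefectOne
open Summit.Langlands.Langlands.Cruxes.ReducibleOrdinaryProModular.SteinbergHyperplane

/-- **Registered sub-goal `stub_presentationBound_auxUnique` of stub `stub_presentationBound` (line
`fine-selmer-codimension-two`, crux stmt-Langlands-12919): the universal nearly ordinary deformation
ring of a residual datum is unique up to an `𝒪`-algebra isomorphism carrying `ρ_𝒟` to `ρ'_𝒟` up to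
strict equivalence** (`Theorems.exists_algEquiv_isStrictEquiv`). [cite: SkinnerWiles1999, §2.1] -/
theorem stub_presentationBound_auxUnique :
    ∀ (F : Type) [Field F] [NumberField F] (p : ℕ) (𝒪 : Type) [CommRing 𝒪] (k : Type) [Field k]
      [Algebra 𝒪 k] (𝒟 : NearlyOrdinaryDatum F p 𝒪 k) (𝓡 𝓡' : NearlyOrdinaryDeformationRing.{0} 𝒟),
      ∃ e : 𝓡.R ≃ₐ[𝒪] 𝓡'.R, Deformation.IsStrictEquiv (𝓡'.π : 𝓡'.R →+* k)
        ((Matrix.GeneralLinearGroup.map ((e : 𝓡.R →ₐ[𝒪] 𝓡'.R) : 𝓡.R →+* 𝓡'.R)).comp 𝓡.ρ) 𝓡'.ρ :=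
  fun _ _ _ _ _ _ _ _ _ _ 𝓡 𝓡' => Theorems.exists_algEquiv_isStrictEquiv 𝓡 𝓡'

/-- **Registered sub-goal `stub_presentationBound_auxTransport`: the conclusion of X2 (every minimal
prime has quotient of Krull dimension `≥ d`) transfers from one universal nearly ordinary deformation
ring of `𝒟` to any other** (`Theorems.forall_le_ringKrullDim_quotient_minimalPrimes_of_nearlyOrdinaryDeformationRing`).
[cite: SkinnerWiles1999, §2.1] -/
theorem stub_presentationBound_auxTransport :
    ∀ (F : Type) [Field F] [NumberField F] (p : ℕ) (𝒪 : Type) [CommRing 𝒪] (k : Type) [Field k]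
      [Algebra 𝒪 k] (𝒟 : NearlyOrdinaryDatum F p 𝒪 k) (𝓡 𝓡' : NearlyOrdinaryDeformationRing.{0} 𝒟)
      (d : WithBot ℕ∞),
      (∀ C : PrimeSpectrum 𝓡.R, C.asIdeal ∈ minimalPrimes 𝓡.R → d ≤ ringKrullDim (𝓡.R ⧸ C.asIdeal)) →
      ∀ C : PrimeSpectrum 𝓡'.R, C.asIdeal ∈ minimalPrimes 𝓡'.R → d ≤ ringKrullDim (𝓡'.R ⧸ C.asIdeal) :=
  fun _ _ _ _ _ _ _ _ _ _ 𝓡 𝓡' _ h C hC =>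
    Theorems.forall_le_ringKrullDim_quotient_minimalPrimes_of_nearlyOrdinaryDeformationRing 𝓡 𝓡' h C hC

/-- **Registered sub-goal `stub_presentationBound_auxKrull`: the commutative-algebra half of X2** — a
presentation `R ≃ A ⧸ I` over a complete equidimensional noetherian local ring `A` with
`n + μ(I) ≤ dim A` forces every minimal prime `C` of `R` to have `dim R/C ≥ n`
(`Theorems.forall_le_ringKrullDim_quotient_of_presentation`). [cite: Matsumura1987, Thm. 13.5 and §5 p. 31] -/
theorem stub_presentationBound_auxKrull :
    ∀ (R : Type) [CommRing R] (A : Type) [CommRing A] [IsNoetherianRing A] [IsLocalRing A]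
      [IsAdicComplete (IsLocalRing.maximalIdeal A) A],
      (∀ 𝔓 ∈ minimalPrimes A, ringKrullDim (A ⧸ 𝔓) = ringKrullDim A) →
      ∀ (I : Ideal A) (_ : R ≃+* A ⧸ I) (n : ℕ), (n : WithBot ℕ∞) + I.spanFinrank ≤ ringKrullDim A →
      ∀ C : PrimeSpectrum R, C.asIdeal ∈ minimalPrimes R → (n : WithBot ℕ∞) ≤ ringKrullDim (R ⧸ C.asIdeal) :=
  fun _ _ A _ _ _ _ heq I e n hn C hC =>
    Theorems.forall_le_ringKrullDim_quotient_of_presentation A heq I e n hn C.asIdeal hC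

end Summit.Langlands.Langlands.Cruxes.ReducibleOrdinaryProModular.FineSelmerCodimensionTwo
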